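import Summits.QuantumFields.YangMills.Theorems.LuscherReductionOneSiteLevelsKacTail
import Summits.QuantumFields.YangMills.Theorems.LuscherReductionOneSiteLevelsKacChart
import Summits.QuantumFields.YangMills.Theorems.LuscherReductionOneSiteLevelsKacJump

/-!
# INNER, layer II (flat data of a physical test function): `gFlat`, `phiFlat`, the constraint dictionary `⟨ψ, φ_i⟩ = 8∫ gFlat·f_i`

Support module of crux `OneSiteLevels` (route `LuscherReduction`, item stmt-QuantumFields-20007; STUB-PLAN
`Cruxes/OneSiteLevels/STUB-PLAN-stub_absUpperInnerAL1.md` §2.2 item II.5, owner ruling INNER-RULING-g16: v12 registers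
`stub_innerOfFlatKac : ∀ k, FlatKacFormBound k → OneSiteAbsUpperInner k`), fleet seat ym-luscher-20007-p2 (LATTICE lane).
Everything here is proved, AL1-free.

For `B ≥ B₁(k)` write `t = λ_b(B)` (`B = 2/t³`), `μ = t/2`, `ℓ = √t = onePhaseScale B`.  For a physical `ψ` the half-weighted inner
piece `g = magWeight B (cos Θ_B · ψ)` is chart-represented by the flat function
`gFlat B ψ = e^{−4B·gnPot μ} · cos θ♭ · chartFn μ ψ` (`θ♭ = Θ_B ∘ gnChart μ pos`), which is measurable, bounded, colour-rotation
invariant (`…KacChart`) and supported in `‖y‖ ≤ 7/√t`.  The `k` lattice constraints are the pull-backs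
`φ_i = (ρ⁻¹ · e^{−4B·gnPot μ} · cos θ♭ · f_i) ∘ gnCoord μ` of the flat constraints `f_i` of `FlatKacFormBound k` (with `κ = 7`), so that
`⟨ψ, φ_i⟩ = 8 ∫ gFlat · f_i`.  Then (`…KacFlatten`, `…KacFlattenJump`, `…KacTail`)
`latticeJump B g + ∫ B·S·g² ≥ 8ρ₀ t (1 − 600t)(flatJumpBall + ∫ V gFlat²) ≥ 8ρ₀ t(1 − 600t)(kacForm t gFlat − t⁻¹√2⁹e^{−49/(4t²)}‖gFlat‖²)`
`≥ 8ρ₀ ‖gFlat‖² (E_k t − C₁ t²) ≥ (E_k t − C₁ t²) ∫ g²` — that assembly is the companion file `…KacInner`; THIS file supplies the flat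
data: measurability, bounds, colour-rotation invariance and support of `gFlat`/`phiFlat`, the chart representation
`magWeight_cos_gnChart`, the dictionary `l2_phiPullback`, and `integrable_potential_mul_sq`.

## WHAT THIS IS NOT
Not the INNER stub `stub_absUpperInnerAL1` itself: that still needs layer III `(∀ k, AL1 k) → ∀ k, FlatKacFormBound k` (FLAT lane).
Femto rung R2b1 vocabulary; AL1-conditional closure lives in the skeleton; NOT an infinite-volume ∕ Clay mass-gap statement.
-/

set_option autoImplicit false

noncomputable section

open MeasureTheory Filter Topology Real
open scoped ENNReal
open Literature.MathematicalPhysics.QuantumFieldTheory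
open Literature.MathematicalPhysics.QuantumLattice
open Literature.Analysis.OperatorTheory.YMMatrixModel

namespace Summit.QuantumFields.YangMills.Theorems.FemtoTransferGap

/-! ### §1. Scalar facts and small lattice lemmas -/

/-- The lattice jump form is nonnegative (`B ≥ 0`). [folklore] -/
theorem latticeJump_nonneg {B : ℝ} (hB : 0 ≤ B) (g : Cfg → ℝ) : 0 ≤ latticeJump B g := by
  unfold latticeJump
  refine div_nonneg (mul_nonneg (by norm_num) (integral_nonneg fun U => integral_nonneg fun V => ?_)) (linkCE_pos hB).le
  exact mul_nonneg (linkE_pos B U V).le (sq_nonneg _)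

/-- `gnPot μ` is measurable (it is `S/8` of the chart configuration). [folklore] -/
theorem measurable_gnPot (μ : ℝ) : Measurable (gnPot μ) := by
  haveI := secondCountableTopology_su2
  have h : gnPot μ = fun y => wilsonAction su2Rep (gnChart μ pos y) / 8 := by
    funext y; rw [wilsonAction_gnChart]; ring
  rw [h]
  exact ((continuous_wilsonAction su2Rep continuous_su2Rep).measurable.comp (measurable_gnChart μ pos)).div_const 8

/-! ### §2. The flat data of a physical test function at coupling `B` -/

/-- The IMS phase in the chart at coupling `B`: `θ♭_B(y) = Θ_B(gnChart (λ_b/2) pos y)`. [folklore] -/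
def thetaFlat (B : ℝ) (y : ZM) : ℝ := onePhase (onePhaseScale B) (gnChart (bareLambda B / 2) pos y)

/-- The magnetic half-weight in the chart: `w_B(y) = e^{−(B/2)·8·gnPot (λ_b/2) y}`. [folklore] -/
def magFlat (B : ℝ) (y : ZM) : ℝ := Real.exp (-(B / 2) * (8 * gnPot (bareLambda B / 2) y))

/-- **The flat representative of the inner piece**: `gFlat B ψ = w_B · cos θ♭_B · chartFn (λ_b/2) ψ`. [cite: Luscher1983, §3] -/
def gFlat (B : ℝ) (ψ : Cfg → ℝ) (y : ZM) : ℝ := magFlat B y * (Real.cos (thetaFlat B y) * chartFn (bareLambda B / 2) ψ y)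

/-- **The flat constraint weight**: `phiFlat B f = ρ⁻¹ · w_B · cos θ♭_B · f` (`ρ = gnDensityReal (λ_b/2)`). [folklore] -/
def phiFlat (B : ℝ) (f : ZM → ℝ) (y : ZM) : ℝ :=
  (gnDensityReal (bareLambda B / 2) y)⁻¹ * (magFlat B y * Real.cos (thetaFlat B y)) * f y

section FlatData

variable {B : ℝ} {ψ : Cfg → ℝ}

/-- `0 < w_B ≤ 1` for `B ≥ 0`. [folklore] -/
theorem magFlat_pos_le_one (hB : 0 ≤ B) (y : ZM) : 0 < magFlat B y ∧ magFlat B y ≤ 1 := by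
  refine ⟨Real.exp_pos _, Real.exp_le_one_iff.2 ?_⟩
  have := gnPot_nonneg (bareLambda B / 2) y
  nlinarith

/-- `magFlat` is measurable. [folklore] -/
theorem measurable_magFlat (B : ℝ) : Measurable (magFlat B) :=
  Real.measurable_exp.comp (measurable_const.mul (measurable_const.mul (measurable_gnPot _)))

/-- `thetaFlat` is measurable. [folklore] -/
theorem measurable_thetaFlat (B : ℝ) : Measurable (thetaFlat B) :=
  (measurable_onePhase _).comp (measurable_gnChart _ pos)

/-- **Chart representation of the inner piece**: `magWeight B (cos Θ_B · ψ) (gnChart (λ_b/2) σ y) = gFlat B ψ y` for all eight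
patterns (physical `ψ`). [cite: Luscher1983, §3] -/
theorem magWeight_cos_gnChart (hψ : IsPhys ψ) (B : ℝ) (σ : Fin 3 → Bool) (y : ZM) :
    magWeight B (fun U => Real.cos (onePhase (onePhaseScale B) U) * ψ U) (gnChart (bareLambda B / 2) σ y) = gFlat B ψ y := by
  rw [magWeight_apply, gFlat, magFlat, thetaFlat, chartFn, wilsonAction_gnChart, onePhase_gnChart (onePhaseScale B) _ σ y,
    hψ.apply_gnChart _ σ y]

/-- `gFlat` is measurable. [folklore] -/
theorem measurable_gFlat (B : ℝ) (hψm : Measurable ψ) : Measurable (gFlat B ψ) :=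
  (measurable_magFlat B).mul ((Real.measurable_cos.comp (measurable_thetaFlat B)).mul (measurable_chartFn _ hψm))

/-- `|gFlat B ψ| ≤ C` when `|ψ| ≤ C` (`B ≥ 0`). [folklore] -/
theorem abs_gFlat_le (hB : 0 ≤ B) {C : ℝ} (hC : ∀ U, |ψ U| ≤ C) (y : ZM) : |gFlat B ψ y| ≤ C := by
  obtain ⟨hw0, hw1⟩ := magFlat_pos_le_one hB y
  rw [gFlat, abs_mul, abs_mul, abs_of_pos hw0]
  have hc : |Real.cos (thetaFlat B y)| ≤ 1 := Real.abs_cos_le_one _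
  have hψ := hC (gnChart (bareLambda B / 2) pos y)
  rw [chartFn]
  have h0 : 0 ≤ |ψ (gnChart (bareLambda B / 2) pos y)| := abs_nonneg _
  calc magFlat B y * (|Real.cos (thetaFlat B y)| * |ψ (gnChart (bareLambda B / 2) pos y)|)
      ≤ 1 * (1 * |ψ (gnChart (bareLambda B / 2) pos y)|) := by gcongr
    _ ≤ C := by simpa using hψ

/-- `gFlat B ψ` is colour-rotation invariant for a physical `ψ`. [cite: Vanbaal2001, §4] -/
theorem isGaugeInv_gFlat (B : ℝ) (hψ : IsPhys ψ) : IsGaugeInv (gFlat B ψ) := by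
  intro R hR y
  rw [gFlat, gFlat, magFlat, magFlat, thetaFlat, thetaFlat, gnPot_colourRotate _ hR, onePhase_gnChart_colourRotate _ _ hR,
    isGaugeInv_chartFn _ hψ R hR]

/-- **Support of the flat representative**: for `2 ≤ B` with `λ_b(B) ≤ 1/4`, `gFlat B ψ y ≠ 0 ⇒ ‖y‖ ≤ 7/√λ_b`. [folklore] -/
theorem norm_le_of_gFlat_ne_zero (hB : 0 < B) (ht4 : bareLambda B ≤ 1 / 4) {y : ZM} (h : gFlat B ψ y ≠ 0) :
    ‖y‖ ≤ 7 / Real.sqrt (bareLambda B) := by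
  have hcos : Real.cos (thetaFlat B y) ≠ 0 := by
    intro h0; apply h; rw [gFlat, h0, zero_mul, mul_zero]
  exact norm_le_of_cos_onePhase_gnChart_ne_zero (bareLambda_pos' hB) ht4 (onePhaseScale_pos hB) (onePhaseScale_sq hB) hcos

/-- `phiFlat` is measurable when `f` is. [folklore] -/
theorem measurable_phiFlat (B : ℝ) {f : ZM → ℝ} (hf : Measurable f) : Measurable (phiFlat B f) :=
  (((measurable_gnDensityReal _).inv).mul ((measurable_magFlat B).mul (Real.measurable_cos.comp (measurable_thetaFlat B)))).mul hf

/-- `phiFlat B f` is colour-rotation invariant when `f` is. [cite: Vanbaal2001, §4] -/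
theorem isGaugeInv_phiFlat (B : ℝ) {f : ZM → ℝ} (hf : IsGaugeInv f) : IsGaugeInv (phiFlat B f) := by
  intro R hR y
  rw [phiFlat, phiFlat, magFlat, magFlat, thetaFlat, thetaFlat, gnDensityReal_colourRotate _ hR, gnPot_colourRotate _ hR,
    onePhase_gnChart_colourRotate _ _ hR, hf R hR]

/-- **`phiFlat B f` is bounded** by `2ρ₀⁻¹ M` when `|f| ≤ M`, `B > 0`, `λ_b ≤ 1/4` and `6μ²·49/λ_b ≤ 1/2` (density `≥ ρ₀/2` on the support
of `cos θ♭`). [folklore] -/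
theorem abs_phiFlat_le (hB : 0 < B) (ht4 : bareLambda B ≤ 1 / 4)
    (hwin : 6 * ((bareLambda B / 2) ^ 2 * (7 / Real.sqrt (bareLambda B)) ^ 2) ≤ 1 / 2) {f : ZM → ℝ} {M : ℝ}
    (hM : ∀ y, |f y| ≤ M) (y : ZM) :
    |phiFlat B f y| ≤ 2 * ((bareLambda B / 2) ^ 9 * ((2 * π ^ 2)⁻¹) ^ 3)⁻¹ * M := by
  set μ : ℝ := bareLambda B / 2 with hμ
  have ht := bareLambda_pos' hB
  have hμ0 : 0 < μ := by positivity
  have hρ₀ : 0 < μ ^ 9 * ((2 * π ^ 2)⁻¹) ^ 3 := by positivity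
  have hM0 : 0 ≤ M := (abs_nonneg _).trans (hM y)
  by_cases hcos : Real.cos (thetaFlat B y) = 0
  · rw [phiFlat, hcos]; simp only [mul_zero, zero_mul, abs_zero]; positivity
  · have hyR : ‖y‖ ≤ 7 / Real.sqrt (bareLambda B) :=
      norm_le_of_cos_onePhase_gnChart_ne_zero ht ht4 (onePhaseScale_pos hB) (onePhaseScale_sq hB) hcos
    have hρ : μ ^ 9 * ((2 * π ^ 2)⁻¹) ^ 3 * (1 - 6 * (μ ^ 2 * (7 / Real.sqrt (bareLambda B)) ^ 2)) ≤ gnDensityReal μ y :=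
      gnDensityReal_ge_of_norm_le hμ0 hyR
    have hρ2 : μ ^ 9 * ((2 * π ^ 2)⁻¹) ^ 3 / 2 ≤ gnDensityReal μ y := by
      refine le_trans ?_ hρ
      have : 1 / 2 ≤ 1 - 6 * (μ ^ 2 * (7 / Real.sqrt (bareLambda B)) ^ 2) := by linarith
      calc μ ^ 9 * ((2 * π ^ 2)⁻¹) ^ 3 / 2 = μ ^ 9 * ((2 * π ^ 2)⁻¹) ^ 3 * (1 / 2) := by ring
        _ ≤ _ := mul_le_mul_of_nonneg_left this hρ₀.le
    have hρpos := gnDensityReal_pos hμ0 y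
    have hinv : (gnDensityReal μ y)⁻¹ ≤ 2 * (μ ^ 9 * ((2 * π ^ 2)⁻¹) ^ 3)⁻¹ := by
      rw [show 2 * (μ ^ 9 * ((2 * π ^ 2)⁻¹) ^ 3)⁻¹ = (μ ^ 9 * ((2 * π ^ 2)⁻¹) ^ 3 / 2)⁻¹ by field_simp]
      exact inv_anti₀ (by positivity) hρ2
    obtain ⟨hw0, hw1⟩ := magFlat_pos_le_one hB.le y
    rw [phiFlat, abs_mul, abs_mul, abs_mul, abs_of_pos (inv_pos.2 hρpos), abs_of_pos hw0]
    have hc : |Real.cos (thetaFlat B y)| ≤ 1 := Real.abs_cos_le_one _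
    calc (gnDensityReal μ y)⁻¹ * (magFlat B y * |Real.cos (thetaFlat B y)|) * |f y|
        ≤ (2 * (μ ^ 9 * ((2 * π ^ 2)⁻¹) ^ 3)⁻¹) * (1 * 1) * M := by
          gcongr
          exact hM y
      _ = 2 * (μ ^ 9 * ((2 * π ^ 2)⁻¹) ^ 3)⁻¹ * M := by ring

/-- **The constraint dictionary**: for physical `ψ`, bounded measurable `f`, and the pull-back `φ = phiFlat B f ∘ gnCoord (λ_b/2)`,
`⟨ψ, φ⟩ = 8 ∫ gFlat B ψ · f` (`B > 0`; the density cancels). [folklore] -/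
theorem l2_phiPullback (hB : 0 < B) (hψ : IsPhys ψ) {f : ZM → ℝ} (hfm : Measurable f) {Cφ : ℝ}
    (hφb : ∀ y, |phiFlat B f y| ≤ Cφ) :
    l2 ψ (fun U : Cfg => phiFlat B f (gnCoord (bareLambda B / 2) U)) = 8 * ∫ y, gFlat B ψ y * f y := by
  set μ : ℝ := bareLambda B / 2 with hμ
  have hμ0 : 0 < μ := by have := bareLambda_pos' hB; positivity
  obtain ⟨C, hC⟩ := hψ.bounded
  have hm : Measurable fun U : Cfg => ψ U * phiFlat B f (gnCoord μ U) :=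
    hψ.measurable.mul ((measurable_phiFlat B hfm).comp (measurable_gnCoord μ))
  have hb : ∃ C' : ℝ, ∀ U : Cfg, |ψ U * phiFlat B f (gnCoord μ U)| ≤ C' :=
    ⟨C * Cφ, fun U => by rw [abs_mul]; exact mul_le_mul (hC U) (hφb _) (abs_nonneg _) ((abs_nonneg _).trans (hC U))⟩
  have hrep : ∀ σ y, (fun U : Cfg => ψ U * phiFlat B f (gnCoord μ U)) (gnChart μ σ y) = chartFn μ ψ y * phiFlat B f y := by
    intro σ y
    show ψ (gnChart μ σ y) * phiFlat B f (gnCoord μ (gnChart μ σ y)) = chartFn μ ψ y * phiFlat B f y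
    rw [gnCoord_gnChart hμ0.ne', hψ.apply_gnChart_eq_chartFn μ σ y]
  unfold l2
  rw [show configMeasure SU2 1 = cfgMeasure from rfl, integral_eq_of_chartRep hμ0 hm hb hrep]
  congr 1
  refine integral_congr_ae (ae_of_all _ fun y => ?_)
  show gnDensityReal μ y * (chartFn μ ψ y * phiFlat B f y) = gFlat B ψ y * f y
  have hρ := (gnDensityReal_pos hμ0 y).ne'
  rw [phiFlat, gFlat, ← hμ]
  field_simp

end FlatData

/-! ### §3. Integrability of the potential term -/

/-- `V · G²` is integrable for a bounded measurable `G` supported in a ball (`V` is continuous). [folklore] -/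
theorem integrable_potential_mul_sq {G : ZM → ℝ} (hGm : Measurable G) {M : ℝ} (hGb : ∀ y, |G y| ≤ M) {R : ℝ}
    (hsupp : ∀ y, G y ≠ 0 → ‖y‖ ≤ R) : Integrable fun y => luscherPotential y * G y ^ 2 := by
  obtain ⟨V₀, hV₀⟩ := (isCompact_closedBall (0 : ZM) R).exists_bound_of_continuousOn continuous_luscherPotential.continuousOn
  have hM0 : 0 ≤ M := (abs_nonneg _).trans (hGb 0)
  refine integrable_of_bounded_of_support (continuous_luscherPotential.measurable.mul (hGm.pow_const 2)) (M := |V₀| * M ^ 2)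
    (R := R) (fun y => ?_) (fun y hy => hsupp y ?_)
  · by_cases h0 : G y = 0
    · rw [h0]; simp; positivity
    · have hy : y ∈ Metric.closedBall (0 : ZM) R := by rw [Metric.mem_closedBall, dist_zero_right]; exact hsupp y h0
      have hV := hV₀ y hy
      rw [abs_mul, abs_pow]
      exact mul_le_mul ((le_abs_self _).trans' hV) (pow_le_pow_left₀ (abs_nonneg _) (hGb y) 2) (by positivity) (abs_nonneg _)
  · intro h; apply hy; rw [h]; ring

end Summit.QuantumFields.YangMills.Theorems.FemtoTransferGap

end
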